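import Mathlib
import Summits.ValiantsHypothesis.ValiantsHypothesis.Theorems.NewtonUnitEquationsNewtonTauWeakCornerDefs

/-!
# `NewtonTauWeak` (stmt-ValiantsHypothesis-5904), stub `fixedKCoincidence_t2_K3` (siege k13): Laurent bookkeeping

First support file of siege k13 on the registered stub `fixedKCoincidence_t2_K3` (FixedKCoincidence at `t = 2`,
`K = 3`, no short 2-vs-1 direction relations; paper proof `Cruxes/NewtonTauWeak/Lines/binomial-normal-form-ltc.md`
§2–§5 + the landed corner rigidity lemma `NewtonTauWeakCorner.corner_rigidity`).  The flip identity
`1 - ρ X^d = (-ρ X^d)(1 - ρ⁻¹ X^{-d})` localising a sum of binomial products at a corner lives in the LAURENT ring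
`L = ℂ[ℤ²]` (`AddMonoidAlgebra ℂ (Fin 2 → ℤ)`), monomials `T z`.  Predicates relative to a real weight `w`
(`NewtonTauWeakCorner.wt`): `IsFirst w x v` (the `w`-initial exponent: nonzero coefficient, all others strictly
heavier), `Conic w x` (support on the origin and positive weights), `Heavy w Ω x` (support of weight `≥ Ω`).
Also the three objects of the later files: `sepProdL E U = Π_e U_e(T^{E_e})` (separated products), `zOf`
(`ℕ² → ℤ²`) and the embedding `lemb : ℂ[X,Y] → L`.  API here: coefficients of shifts/products/sums and first
points (uniqueness, existence for injective weights, shifts, scalars, heavier junk). [folklore]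
-/

-- the namespace mandated for this Theorems file repeats the component `ValiantsHypothesis`
set_option linter.dupNamespace false

noncomputable section

open scoped BigOperators
open AddMonoidAlgebra

namespace Summit.ValiantsHypothesis.ValiantsHypothesis.Theorems.NewtonTauWeakSiegeK13

open Summit.ValiantsHypothesis.ValiantsHypothesis.Theorems.NewtonTauWeakCorner (wt wt_add wt_zero wt_zsmul)

/-! ## The Laurent ring and its monomials -/

/-- The Laurent polynomial ring `ℂ[ℤ²]` in two variables (group algebra of `ℤ²`). [folklore] -/
abbrev L : Type := AddMonoidAlgebra ℂ (Fin 2 → ℤ)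

/-- The Laurent monomial `T^z`, `z ∈ ℤ²`. [folklore] -/
abbrev T (z : Fin 2 → ℤ) : L := AddMonoidAlgebra.single z 1

/-- `v` is the `w`-initial exponent of `x`: a nonzero coefficient, every other one strictly heavier. [folklore] -/
def IsFirst (w : Fin 2 → ℝ) (x : L) (v : Fin 2 → ℤ) : Prop :=
  x.coeff v ≠ 0 ∧ ∀ z, x.coeff z ≠ 0 → z ≠ v → wt w v < wt w z

/-- `x` is conic: supported on the origin and on points of positive weight. [folklore] -/
def Conic (w : Fin 2 → ℝ) (x : L) : Prop :=
  ∀ z, x.coeff z ≠ 0 → z = 0 ∨ 0 < wt w z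

/-- `x` is heavy above `Ω`: every support point weighs at least `Ω`. [folklore] -/
def Heavy (w : Fin 2 → ℝ) (Ω : ℝ) (x : L) : Prop :=
  ∀ z, x.coeff z ≠ 0 → Ω ≤ wt w z

/-- The separated product `Π_e U_e(T^{E_e})` of univariate polynomials along directions `E_e ∈ ℤ²`. [folklore] -/
def sepProdL {s : ℕ} (E : Fin s → Fin 2 → ℤ) (U : Fin s → Polynomial ℂ) : L :=
  ∏ e, Polynomial.aeval (T (E e)) (U e)

/-- The exponent of a bivariate monomial as a point of `ℤ²`. [folklore] -/
def zOf (e : Fin 2 →₀ ℕ) : Fin 2 → ℤ := fun i => ((e i : ℕ) : ℤ)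

/-- The embedding `ℂ[X,Y] → ℂ[ℤ²]` of bivariate polynomials into Laurent polynomials (`X_i ↦ T^{e_i}`). [folklore] -/
def lemb : MvPolynomial (Fin 2) ℂ →ₐ[ℂ] L :=
  MvPolynomial.aeval fun i : Fin 2 => T (Pi.single i 1)

variable (w : Fin 2 → ℝ)

/-- The weight of a difference. [folklore] -/
theorem wt_sub' (a b : Fin 2 → ℤ) : wt w (a - b) = wt w a - wt w b := by
  rw [eq_sub_iff_add_eq, ← wt_add, sub_add_cancel]

/-- `T^0 = 1`. [folklore] -/
theorem T_zero : T 0 = (1 : L) := rfl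

/-- `T^{a+b} = T^a T^b`. [folklore] -/
theorem T_add (a b : Fin 2 → ℤ) : T (a + b) = T a * T b := by
  rw [single_mul_single, mul_one]

/-- Coefficients of a monomial. [folklore] -/
theorem coeff_T (a z : Fin 2 → ℤ) : (T a).coeff z = if a = z then (1 : ℂ) else 0 := by
  classical
  simp [Finsupp.single_apply]

/-- Coefficients of a shift: `[T^a x]_z = x_{z-a}`. [folklore] -/
theorem coeff_T_mul (a : Fin 2 → ℤ) (x : L) (z : Fin 2 → ℤ) : (T a * x).coeff z = x.coeff (z - a) := by
  rw [coeff_single_mul_apply, one_mul, neg_add_eq_sub]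

/-- Coefficients of a shift at a shifted point. [folklore] -/
theorem coeff_T_mul_add (a : Fin 2 → ℤ) (x : L) (z : Fin 2 → ℤ) : (T a * x).coeff (a + z) = x.coeff z := by
  rw [coeff_T_mul, add_sub_cancel_left]

/-- Coefficients of a product as a sum over the support of the right factor. [folklore] -/
theorem coeff_mul_eq_sum (x y : L) (z : Fin 2 → ℤ) :
    (x * y).coeff z = ∑ b ∈ y.coeff.support, x.coeff (z - b) * y.coeff b := by
  rw [coeff_mul_apply_right]
  simp [Finsupp.sum, sub_eq_add_neg]

/-- A nonzero coefficient of a product comes from a pair of nonzero coefficients. [folklore] -/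
theorem exists_of_coeff_mul_ne_zero {x y : L} {z : Fin 2 → ℤ} (h : (x * y).coeff z ≠ 0) :
    ∃ a b, a + b = z ∧ x.coeff a ≠ 0 ∧ y.coeff b ≠ 0 := by
  rw [coeff_mul_eq_sum] at h
  obtain ⟨b, hb, hne⟩ := Finset.exists_ne_zero_of_sum_ne_zero h
  exact ⟨z - b, b, sub_add_cancel z b, left_ne_zero_of_mul hne, right_ne_zero_of_mul hne⟩

/-- Coefficients of sums. [folklore] -/
theorem coeff_add_apply (x y : L) (z : Fin 2 → ℤ) : (x + y).coeff z = x.coeff z + y.coeff z := rfl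

/-- Coefficients of differences. [folklore] -/
theorem coeff_sub_apply (x y : L) (z : Fin 2 → ℤ) : (x - y).coeff z = x.coeff z - y.coeff z := rfl

/-- Coefficients of scalar multiples. [folklore] -/
theorem coeff_smul_apply (c : ℂ) (x : L) (z : Fin 2 → ℤ) : (c • x).coeff z = c * x.coeff z := rfl

/-- Coefficients of finite sums. [folklore] -/
theorem coeff_finset_sum_apply {ι : Type*} (s : Finset ι) (f : ι → L) (z : Fin 2 → ℤ) :
    (∑ i ∈ s, f i).coeff z = ∑ i ∈ s, (f i).coeff z := by
  rw [coeff_sum, Finsupp.finsetSum_apply]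

/-- Coefficients of `1`. [folklore] -/
theorem coeff_one_apply (z : Fin 2 → ℤ) : (1 : L).coeff z = if (0 : Fin 2 → ℤ) = z then (1 : ℂ) else 0 := by
  rw [← T_zero, coeff_T]

/-! ## First points -/

variable {w}

/-- A first point carries a nonzero coefficient. [folklore] -/
theorem IsFirst.coeff_ne_zero {x : L} {v : Fin 2 → ℤ} (h : IsFirst w x v) : x.coeff v ≠ 0 := h.1

/-- Everything strictly lighter than the first point vanishes. [folklore] -/
theorem IsFirst.coeff_eq_zero_of_lt {x : L} {v : Fin 2 → ℤ} (h : IsFirst w x v) {z : Fin 2 → ℤ}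
    (hz : wt w z < wt w v) : x.coeff z = 0 := by
  by_contra hne
  have hzv : z ≠ v := fun hzv => by rw [hzv] at hz; exact lt_irrefl _ hz
  exact lt_asymm hz (h.2 z hne hzv)

/-- Everything of weight at most the first point's, other than the first point, vanishes. [folklore] -/
theorem IsFirst.coeff_eq_zero_of_le {x : L} {v : Fin 2 → ℤ} (h : IsFirst w x v) {z : Fin 2 → ℤ}
    (hz : wt w z ≤ wt w v) (hzv : z ≠ v) : x.coeff z = 0 := by
  by_contra hne
  exact not_lt.mpr hz (h.2 z hne hzv)

/-- An element with a first point is nonzero. [folklore] -/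
theorem IsFirst.ne_zero {x : L} {v : Fin 2 → ℤ} (h : IsFirst w x v) : x ≠ 0 := by
  rintro rfl
  exact h.1 rfl

/-- The first point is unique. [folklore] -/
theorem IsFirst.unique {x : L} {v v' : Fin 2 → ℤ} (h : IsFirst w x v) (h' : IsFirst w x v') : v = v' := by
  by_contra hne
  exact lt_asymm (h.2 v' h'.1 (Ne.symm hne)) (h'.2 v h.1 hne)

/-- A nonzero coefficient weighs at least the first point. [folklore] -/
theorem IsFirst.le_of_coeff_ne_zero {x : L} {v : Fin 2 → ℤ} (h : IsFirst w x v) {z : Fin 2 → ℤ}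
    (hz : x.coeff z ≠ 0) : wt w v ≤ wt w z := by
  by_cases hzv : z = v
  · rw [hzv]
  · exact (h.2 z hz hzv).le

/-- Constructor from "nonzero at `v`, zero at every other point of weight `≤ wt v`". [folklore] -/
theorem isFirst_of_forall_le {x : L} {v : Fin 2 → ℤ} (hv : x.coeff v ≠ 0)
    (h : ∀ z, z ≠ v → wt w z ≤ wt w v → x.coeff z = 0) : IsFirst w x v :=
  ⟨hv, fun z hz hzv => lt_of_not_ge fun hle => hz (h z hzv hle)⟩

/-- For an injective weight every nonzero element has a first point. [folklore] -/
theorem exists_isFirst (hgen : Function.Injective (wt w)) {x : L} (hx : x ≠ 0) : ∃ v, IsFirst w x v := by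
  have hne : x.coeff.support.Nonempty := by
    rw [Finsupp.support_nonempty_iff, Ne, ← coeff_zero (R := ℂ) (M := Fin 2 → ℤ), coeff_inj]
    exact hx
  obtain ⟨v, hv, hmin⟩ := Finset.exists_min_image x.coeff.support (wt w) hne
  refine ⟨v, Finsupp.mem_support_iff.mp hv, fun z hz hzv => ?_⟩
  exact lt_of_le_of_ne (hmin z (Finsupp.mem_support_iff.mpr hz)) fun heq => hzv (hgen heq).symm

/-- First points of shifts. [folklore] -/
theorem isFirst_T_mul_iff (a : Fin 2 → ℤ) (x : L) (v : Fin 2 → ℤ) :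
    IsFirst w (T a * x) (a + v) ↔ IsFirst w x v := by
  constructor
  · rintro ⟨hv, h⟩
    rw [coeff_T_mul_add] at hv
    refine ⟨hv, fun z hz hzv => ?_⟩
    have h' := h (a + z) (by rwa [coeff_T_mul_add]) (fun heq => hzv (add_left_cancel heq))
    rw [wt_add, wt_add] at h'
    linarith
  · rintro ⟨hv, h⟩
    refine ⟨by rwa [coeff_T_mul_add], fun z hz hzv => ?_⟩
    rw [coeff_T_mul] at hz
    have h' := h (z - a) hz (fun heq => hzv (by rw [← heq, add_sub_cancel]))
    rw [show z = a + (z - a) by abel, wt_add, wt_add]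
    linarith

/-- First points are insensitive to nonzero scalars. [folklore] -/
theorem isFirst_smul_iff {c : ℂ} (hc : c ≠ 0) (x : L) (v : Fin 2 → ℤ) :
    IsFirst w (c • x) v ↔ IsFirst w x v := by
  simp only [IsFirst, coeff_smul_apply, mul_ne_zero_iff, ne_eq, hc, not_false_eq_true, true_and]

/-- Adding junk strictly heavier than the first point keeps the first point. [folklore] -/
theorem IsFirst.add_of_forall_lt {x y : L} {v : Fin 2 → ℤ} (h : IsFirst w x v)
    (hy : ∀ z, y.coeff z ≠ 0 → wt w v < wt w z) : IsFirst w (x + y) v := by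
  refine isFirst_of_forall_le ?_ fun z hzv hle => ?_
  · have : y.coeff v = 0 := by
      by_contra hne
      exact lt_irrefl _ (hy v hne)
    rw [coeff_add_apply, this, add_zero]
    exact h.1
  · have hy0 : y.coeff z = 0 := by
      by_contra hne
      exact not_lt.mpr hle (hy z hne)
    rw [coeff_add_apply, hy0, add_zero, h.coeff_eq_zero_of_le hle hzv]

/-- Adding junk heavy above a threshold beyond the first point keeps the first point. [folklore] -/
theorem IsFirst.add_heavy {x y : L} {v : Fin 2 → ℤ} {Ω : ℝ} (h : IsFirst w x v) (hy : Heavy w Ω y)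
    (hΩ : wt w v < Ω) : IsFirst w (x + y) v :=
  h.add_of_forall_lt fun z hz => lt_of_lt_of_le hΩ (hy z hz)

end Summit.ValiantsHypothesis.ValiantsHypothesis.Theorems.NewtonTauWeakSiegeK13

end
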